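import Summits.AtomisticToContinuum.Crystallization.Theses.OneGrainWindow
import Literature.Algebra.EuclideanLattices.IntegerBases

/-!
# Refutation of `OneGrainWindow.OneGrainGluing` (stmt-AtomisticToContinuum-3506): multiplicity

`OneGrainGluing` (route `AtomisticToContinuum/Crystallization/OneGrainWindow`, crux rank 3) says: for
every periodic `P` there is `R₀` such that for all `R₁ ≥ R₀`, `R, ε > 0` there are `θ > 0`, `M ∈ ℕ`
with: every finite configuration `x : Fin N → ℝ³` with `M · #Bad(R₁, θ) < N` has a particle carrying a
radius-`R` window `ε`-matched (both ways) to `P`. The matching predicate is multiplicity-blind and the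
configuration is neither assumed injective nor uniformly separated, so `N` can be inflated at no cost in
`#Bad`: take `P = ℤ³` (one-point motif), `R₁ = m := ⌈R₀⌉₊`, `R = 2m + 1`, `ε = 1/2`; given `θ, M`, let
`S = ℤ³ ∩ B(0, m)` (`c` points) and let `x` list `S` once and then the origin `M·c + 1` more times.
Every origin particle is matched at radius `m` exactly (its `m`-environment is all of `S`, and every
particle sits on a lattice site), so `#Bad ≤ c` and `M · #Bad ≤ M c < N = c + M c + 1`; but every
particle has norm `≤ m`, so the lattice point `(2m+1) e₀` of the radius-`R` window of any particle,
under any isometry `A`, lands at distance `≥ 1 > ε` from all particles: no window exists.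
FIX (planner restate): add uniform separation of `x` (`∀ i ≠ j, δ ≤ dist (x i) (x j)`, with `θ, M`
allowed to depend on `δ`; `δ = 1/3` suffices for the Assembly by `LennardJonesMinimalDistance_holds`),
or count Bad particles with multiplicity-aware matching.
All auxiliary facts are `have`s inside the single theorem (refuter files carry negations only).
Route review 2026-08-15, refuter-rreview-route-Schanuel-ExpMordel-ca79690f-0.
-/

noncomputable section

namespace Summit.AtomisticToContinuum.Crystallization.Theorems

open Metric
open Literature.MathematicalPhysics.StatisticalMechanics Literature.Algebra.EuclideanLattices

/-- Refutes `OneGrainWindow.OneGrainGluing` (stmt-AtomisticToContinuum-3506): for `P = ℤ³`, any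
`R₀`, `R₁ = ⌈R₀⌉₊ =: m`, `R = 2m+1`, `ε = 1/2` and any `θ > 0`, `M`, the configuration "`ℤ³ ∩ B(0,m)`
once, plus `M·#(ℤ³ ∩ B(0,m)) + 1` further particles at the origin" has `M · #Bad < N` (the origin
particles are exactly matched; matching is multiplicity-blind) but no particle carries a radius-`R`
window (all particles lie in `B(0, m)`). Witness: piling particles on one good site. [folklore] -/
theorem OneGrainWindowOneGrainGluing_refuted :
    ¬ Summit.AtomisticToContinuum.Crystallization.Theses.OneGrainWindow.OneGrainGluing := by
  classical
  intro h
  /- (0) counting: if the last `K` indices are good, at most `c` indices are bad. -/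
  have card_le : ∀ {c K : ℕ} (Bad : Fin (c + K) → Prop),
      (∀ k : Fin K, ¬ Bad (Fin.natAdd c k)) → Nat.card {i // Bad i} ≤ c := by
    intro c K Bad hB
    have hlt : ∀ i : {i // Bad i}, (i.1 : ℕ) < c := by
      intro i
      by_contra hci
      push Not at hci
      have hi : (i.1 : ℕ) < c + K := i.1.2
      have hk : (i.1 : ℕ) - c < K := by omega
      refine hB ⟨(i.1 : ℕ) - c, hk⟩ ?_
      have heq : Fin.natAdd c ⟨(i.1 : ℕ) - c, hk⟩ = i.1 := by
        apply Fin.ext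
        simp only [Fin.val_natAdd]
        omega
      rw [heq]
      exact i.2
    have hf : Function.Injective (fun i : {i // Bad i} => (⟨i.1, hlt i⟩ : Fin c)) := by
      intro a b hab
      exact Subtype.ext (Fin.ext (by simpa using congrArg Fin.val hab))
    simpa using Nat.card_le_card_of_injective _ hf
  /- (1) the simple cubic crystal `ℤ³`: lattice of periods `ℤ³`, one-point motif `{0}`. -/
  obtain ⟨P, hPm, hPl⟩ : ∃ P : PeriodicConfiguration 3,
      P.motif = {0} ∧ P.lattice = stdIntLattice 3 :=
    ⟨{ lattice := stdIntLattice 3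
       discrete := inferInstance
       isZLattice := inferInstance
       motif := {0}
       motif_nonempty := ⟨0, Finset.mem_singleton_self 0⟩
       eq_of_sub_mem := fun x hx y hy _ => by
         rw [Finset.mem_singleton.1 hx, Finset.mem_singleton.1 hy] }, rfl, rfl⟩
  have hpts : ∀ z, z ∈ P.points ↔ z ∈ stdIntLattice 3 := by
    intro z
    simp only [PeriodicConfiguration.points, hPm, hPl, Finset.mem_singleton, Set.mem_setOf_eq]
    constructor
    · rintro ⟨y, rfl, g, hg, rfl⟩
      rwa [zero_add]
    · intro hz
      exact ⟨0, rfl, z, hz, (zero_add z).symm⟩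
  have h0motif : (0 : EuclideanSpace ℝ (Fin 3)) ∈ P.motif := by
    rw [hPm]; exact Finset.mem_singleton_self 0
  obtain ⟨R₀, h⟩ := h P
  /- (2) radii: `R₁ = m ≥ R₀`, window radius `R = 2m + 1`, tolerance `ε = 1/2`. -/
  obtain ⟨m, hm⟩ : ∃ m : ℕ, R₀ ≤ m := ⟨⌈R₀⌉₊, Nat.le_ceil R₀⟩
  obtain ⟨θ, hθ, M, hM⟩ := h m hm (2 * m + 1) (1 / 2) (by positivity) (by norm_num)
  /- (3) the block `S = ℤ³ ∩ B(0, m)`, `c = #S`. -/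
  have hfin : (closedBall (0 : EuclideanSpace ℝ (Fin 3)) m ∩ P.points).Finite :=
    P.finite_inter_points isBounded_closedBall
  obtain ⟨S, hmemS⟩ : ∃ S : Finset (EuclideanSpace ℝ (Fin 3)),
      ∀ z, z ∈ S ↔ ‖z‖ ≤ m ∧ z ∈ P.points :=
    ⟨hfin.toFinset, fun z => by
      rw [Set.Finite.mem_toFinset, Set.mem_inter_iff, mem_closedBall_zero_iff]⟩
  set c : ℕ := S.card with hc
  /- (4) the configuration: `S` once, then `M c + 1` particles at the origin. -/
  obtain ⟨x, hx0, hxS⟩ : ∃ x : Fin (c + (M * c + 1)) → EuclideanSpace ℝ (Fin 3),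
      (∀ k, x (Fin.natAdd c k) = 0) ∧
      (∀ k, x (Fin.castAdd (M * c + 1) k) = (S.equivFin.symm k : EuclideanSpace ℝ (Fin 3))) :=
    ⟨Fin.append (fun k : Fin c => (S.equivFin.symm k : EuclideanSpace ℝ (Fin 3))) (fun _ => 0),
      fun k => Fin.append_right _ _ k, fun k => Fin.append_left _ _ k⟩
  have hxmem : ∀ j, ‖x j‖ ≤ m ∧ x j ∈ P.points := by
    intro j
    induction j using Fin.addCases with
    | left k =>
      rw [hxS]
      exact (hmemS _).1 (S.equivFin.symm k).2
    | right k =>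
      rw [hx0, norm_zero]
      exact ⟨Nat.cast_nonneg m, (hpts 0).2 (Submodule.zero_mem _)⟩
  /- (5) every origin particle is matched at radius `m`, both ways, with `p₀ = 0`, `A = id`. -/
  have hC1 : ∀ k, ∀ p ∈ P.points, dist p 0 ≤ (m : ℝ) → ∃ j, dist (x j)
      (x (Fin.natAdd c k) + (LinearIsometryEquiv.refl ℝ (EuclideanSpace ℝ (Fin 3))) (p - 0)) ≤ θ := by
    intro k p hp hpd
    have hpS : p ∈ S := (hmemS p).2 ⟨by rwa [dist_zero_right] at hpd, hp⟩
    refine ⟨Fin.castAdd (M * c + 1) (S.equivFin ⟨p, hpS⟩), ?_⟩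
    rw [hxS, Equiv.symm_apply_apply, hx0]
    simp [hθ.le]
  have hC2 : ∀ k, ∀ j, dist (x j) (x (Fin.natAdd c k)) ≤ (m : ℝ) → ∃ p ∈ P.points, dist (x j)
      (x (Fin.natAdd c k) + (LinearIsometryEquiv.refl ℝ (EuclideanSpace ℝ (Fin 3))) (p - 0)) ≤ θ := by
    intro k j _
    refine ⟨x j, (hxmem j).2, ?_⟩
    rw [hx0]
    simp [hθ.le]
  have hx := hM (c + (M * c + 1)) x
  dsimp only at hx
  refine absurd (hx ?_) ?_
  · /- (6) `M · #Bad ≤ M c < N`. -/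
    refine lt_of_le_of_lt (Nat.mul_le_mul_left M
      (card_le _ fun k => not_not_intro
        ⟨0, h0motif, LinearIsometryEquiv.refl ℝ _, hC1 k, hC2 k⟩)) ?_
    omega
  · /- (7) no particle carries a window of radius `2m + 1`. -/
    rintro ⟨i, p₀, hp₀, A, hA1, -⟩
    rw [hPm, Finset.mem_singleton] at hp₀
    subst hp₀
    simp only [sub_zero] at hA1
    set p : EuclideanSpace ℝ (Fin 3) := EuclideanSpace.single 0 (2 * (m : ℝ) + 1) with hp
    have hpmem : p ∈ P.points := by
      refine (hpts p).2 ((mem_stdIntLattice_iff p).2 fun j => ?_)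
      by_cases hj : j = 0
      · subst hj
        exact ⟨2 * m + 1, by simp [hp]⟩
      · exact ⟨0, by simp [hp, hj]⟩
    have hpn : ‖p‖ = 2 * m + 1 := by
      rw [hp, PiLp.norm_single, Real.norm_eq_abs, abs_of_nonneg (by positivity)]
    obtain ⟨j, hj⟩ := hA1 p hpmem (le_of_eq (by rw [dist_zero_right, hpn]))
    have h1 : dist (x i + A p) (x i) = 2 * m + 1 := by
      rw [dist_eq_norm, add_sub_cancel_left, LinearIsometryEquiv.norm_map, hpn]
    have h2 : dist (x j) (x i) ≤ m + m :=
      (dist_le_norm_add_norm _ _).trans (add_le_add (hxmem j).1 (hxmem i).1)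
    have h3 := dist_triangle (x i + A p) (x j) (x i)
    rw [dist_comm (x i + A p) (x j)] at h3
    linarith

end Summit.AtomisticToContinuum.Crystallization.Theorems

end
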